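import Literature.NumberTheory.LFunctions.RayClassExplicitFormula
import Literature.NumberTheory.LFunctions.RayClassSmoothedCosets
import HarnessLib

/-!
# Smoothed von Mangoldt sums over a coset of a congruence class group and their character expansion

Topic `Literature/NumberTheory/LFunctions`, namespace `Literature.NumberTheory.LFunctions.AbelianDensity`; the ray-class
counterpart of the tree's `ClassGroupSmoothedPsi.lean`.  Everything here is PROVED; `fiberIndicatorIdeal`,
`vonMangoldtFiber`, `smoothedPsiFiber` are definitions with bodies.

For an abelian Frobenius datum `f : 𝔭 ↦ f 𝔭 ∈ G` (`F = artinSymbol f` its multiplicative extension), a modulus `𝔪` and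
`τ ∈ G` (e.g. `G = J^𝔪/H` for a congruence class group `H ⊇ P^𝔪`, `τ` a coset of `H`):
* `vonMangoldtFiber 𝔪 f τ n = Λ_τ(n) = Σ_{N𝔫 = n, (𝔫,𝔪) = 1, F(𝔫) = τ} Λ(𝔫)` (`0 ≤ Λ_τ(n) ≤ Λ_K(n) ≤ n_K Λ(n)`);
* `smoothedPsiFiber 𝔪 f τ g = ψ̃_τ(g) = Σ_n Λ_τ(n) g(log n)` (Thorner–Zaman's `ψ̃_C(x; f)`, [ThornerZaman2017, (3.3)/(8.1)]);
* orthogonality: `Σ_χ χ(τ)⁻¹ Λ^𝔪_χ(n) = |G| · Λ_τ(n)` (`sum_char_inv_mul_rcCoef`, `Λ^𝔪_χ = rcCoef 𝔪 (χ ∘ f)` the von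
  Mangoldt coefficients of the imprimitive `L_𝔪(s, χ ∘ f)`) and
  **`|G| · ψ̃_τ(g) = Σ_χ χ(τ)⁻¹ K_{g, Λ^𝔪_χ}(0)`** (`card_mul_smoothedPsiFiber`), `K_{g,a}(0) = Σ_n a(n) g(log n)` the tree's
  `coefFordK a g 0` — the passage from coset sums to character sums for the smoothed prime-power sums
  [ThornerZaman2017, §8 (8.2)–(8.3)]; [Weiss1983, §5].

## References
* [ThornerZaman2017] J. Thorner, A. Zaman, Algebra Number Theory 11 (2017), §3 (3.3), §8 (8.1)–(8.3).
* [Weiss1983] A. Weiss, J. reine angew. Math. 338 (1983), §5.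
-/

noncomputable section

open Complex Finset IsDedekindDomain NumberField
open scoped NumberField nonZeroDivisors

namespace Literature.NumberTheory.LFunctions.AbelianDensity

open Literature.NumberTheory.LFunctions.NumberField
open scoped Classical

variable {K : Type} [Field K] [NumberField K]
variable {G : Type*} [CommGroup G] [Finite G] {𝔪 : Ideal (𝓞 K)} {f : HeightOneSpectrum (𝓞 K) → G}

/-! ### `Λ_τ(n)` -/

variable (𝔪 f) in
/-- The coset indicator on ideals: `𝟙_τ(𝔫) = 1` if `𝔫 ≠ 0`, `(𝔫, 𝔪) = 1` and `F(𝔫) = τ`, else `0`.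
[cite: ThornerZaman2017, §3 (3.3)] -/
def fiberIndicatorIdeal (τ : G) (I : Ideal (𝓞 K)) : ℝ :=
  if I ≠ ⊥ ∧ IsCoprime I 𝔪 ∧ artinSymbol f I = τ then 1 else 0

variable (𝔪 f) in
/-- **`Λ_τ(n) = Σ_{N𝔫 = n, (𝔫,𝔪)=1, F(𝔫) = τ} Λ(𝔫)`**, the von Mangoldt function of the coset `τ` collected by norm.
[cite: ThornerZaman2017, §3 (3.3)] -/
def vonMangoldtFiber (τ : G) (n : ℕ) : ℝ :=
  ∑ I ∈ idealsOfNorm K n, fiberIndicatorIdeal 𝔪 f τ I * idealVonMangoldt I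

omit [Finite G] in
/-- `0 ≤ 𝟙_τ ≤ 1`. [cite: ThornerZaman2017, §3 (3.3)] -/
theorem fiberIndicatorIdeal_mem (τ : G) (I : Ideal (𝓞 K)) :
    0 ≤ fiberIndicatorIdeal 𝔪 f τ I ∧ fiberIndicatorIdeal 𝔪 f τ I ≤ 1 := by
  unfold fiberIndicatorIdeal
  split_ifs <;> norm_num

omit [Finite G] in
/-- `Λ_τ(n) ≥ 0`. [cite: ThornerZaman2017, §3 (3.3)] -/
theorem vonMangoldtFiber_nonneg (τ : G) (n : ℕ) : 0 ≤ vonMangoldtFiber 𝔪 f τ n :=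
  sum_nonneg fun I _ ↦ mul_nonneg (fiberIndicatorIdeal_mem τ I).1 (idealVonMangoldt_nonneg I)

omit [Finite G] in
/-- `Λ_τ(n) ≤ Λ_K(n)`. [cite: ThornerZaman2017, §3 (3.3)] -/
theorem vonMangoldtFiber_le_vonMangoldtNorm (τ : G) (n : ℕ) : vonMangoldtFiber 𝔪 f τ n ≤ vonMangoldtNorm K n := by
  unfold vonMangoldtFiber vonMangoldtNorm
  refine sum_le_sum fun I _ ↦ ?_
  have h : 0 ≤ fiberIndicatorIdeal 𝔪 f τ I ∧ fiberIndicatorIdeal 𝔪 f τ I ≤ 1 := fiberIndicatorIdeal_mem τ I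
  have h0 := idealVonMangoldt_nonneg I
  nlinarith

omit [Finite G] in
/-- `Λ_τ(n) ≤ n_K Λ(n)`. [cite: ThornerZaman2017, §3 (3.3)] -/
theorem vonMangoldtFiber_le (τ : G) (n : ℕ) :
    vonMangoldtFiber 𝔪 f τ n ≤ Module.finrank ℚ K * ArithmeticFunction.vonMangoldt n :=
  (vonMangoldtFiber_le_vonMangoldtNorm τ n).trans (vonMangoldtNorm_le_finrank_mul n)

omit [Finite G] in
/-- `Λ_τ(0) = 0`. [cite: ThornerZaman2017, §3 (3.3)] -/
theorem vonMangoldtFiber_zero (τ : G) : vonMangoldtFiber 𝔪 f τ 0 = 0 := by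
  unfold vonMangoldtFiber
  refine sum_eq_zero fun I hI ↦ ?_
  rw [mem_idealsOfNorm, Ideal.absNorm_eq_zero_iff] at hI
  simp [fiberIndicatorIdeal, hI]

/-! ### Orthogonality for `Λ^𝔪_χ(n)` -/

/-- Pointwise orthogonality: `Σ_χ χ(τ)⁻¹ χ_𝔪(𝔫) = |G| 𝟙_τ(𝔫)` (`χ_𝔪(𝔫) = rayClassCoeff 𝔪 (χ ∘ f) 𝔫`).
[cite: ThornerZaman2017, §8 (8.2)] -/
theorem sum_char_inv_mul_rayClassCoeff (τ : G) (I : Ideal (𝓞 K)) :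
    ∑ χ : AddChar (Additive G) ℂ, (χ (Additive.ofMul τ))⁻¹ * rayClassCoeff 𝔪 (charFun f χ) I =
      (Nat.card G : ℂ) * (fiberIndicatorIdeal 𝔪 f τ I : ℝ) := by
  by_cases hI : I ≠ ⊥ ∧ IsCoprime I 𝔪
  · simp only [rayClassCoeff_charFun_eq, if_pos hI]
    have hχ : ∀ χ : AddChar (Additive G) ℂ, χ (Additive.ofMul (artinSymbol f I)) = toMulHom χ (artinSymbol f I) :=
      fun χ ↦ rfl
    simp only [hχ, sum_char_inv_mul]
    unfold fiberIndicatorIdeal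
    by_cases hτ : artinSymbol f I = τ
    · rw [if_pos hτ, if_pos ⟨hI.1, hI.2, hτ⟩]; simp
    · rw [if_neg hτ, if_neg (fun h ↦ hτ h.2.2)]; simp
  · simp only [rayClassCoeff_charFun_eq, if_neg hI, mul_zero, sum_const_zero]
    unfold fiberIndicatorIdeal
    rw [if_neg (fun h ↦ hI ⟨h.1, h.2.1⟩)]; simp

/-- **Orthogonality**: `Σ_χ χ(τ)⁻¹ Λ^𝔪_χ(n) = |G| · Λ_τ(n)`, `Λ^𝔪_χ = rcCoef 𝔪 (χ ∘ f)` the von Mangoldt coefficients of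
`L_𝔪(s, χ ∘ f)`. [cite: ThornerZaman2017, §8 (8.2)] -/
theorem sum_char_inv_mul_rcCoef (τ : G) (n : ℕ) :
    ∑ χ : AddChar (Additive G) ℂ, (χ (Additive.ofMul τ))⁻¹ * rcCoef 𝔪 (charFun f χ) n =
      (Nat.card G : ℂ) * (vonMangoldtFiber 𝔪 f τ n : ℝ) := by
  simp only [rcCoef, twistVonMangoldt, rayClassCoeffHom_apply, mul_sum]
  rw [sum_comm]
  unfold vonMangoldtFiber
  rw [ofReal_sum, mul_sum]
  refine sum_congr rfl fun I _ ↦ ?_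
  simp_rw [← mul_assoc]
  rw [← sum_mul, sum_char_inv_mul_rayClassCoeff, ofReal_mul]
  ring

/-! ### The smoothed coset sum `ψ̃_τ` -/

variable (𝔪 f) in
/-- **`ψ̃_τ(g) = Σ_n Λ_τ(n) g(log n)`** (a finite sum when `g` has compact support). [cite: ThornerZaman2017, §8 (8.1)] -/
def smoothedPsiFiber (τ : G) (g : ℝ → ℝ) : ℝ :=
  ∑' n : ℕ, vonMangoldtFiber 𝔪 f τ n * g (Real.log n)

omit [Finite G] in
/-- `ψ̃_τ(g)` as a finite sum when `g = 0` on `[x₀, ∞)` and `x₀ ≤ log N`. [cite: ThornerZaman2017, §8 (8.1)] -/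
theorem smoothedPsiFiber_eq_sum (τ : G) {g : ℝ → ℝ} {x₀ : ℝ} (hg : ∀ u, x₀ ≤ u → g u = 0)
    {N : ℕ} (hN : 1 ≤ N) (hx : x₀ ≤ Real.log N) :
    smoothedPsiFiber 𝔪 f τ g = ∑ n ∈ Finset.range N, vonMangoldtFiber 𝔪 f τ n * g (Real.log n) := by
  rw [smoothedPsiFiber, tsum_eq_sum]
  intro n hn
  rw [Finset.mem_range, not_lt] at hn
  have hlog : x₀ ≤ Real.log n := hx.trans (Real.log_le_log (by exact_mod_cast hN) (by exact_mod_cast hn))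
  simp [hg _ hlog]

/-- **`|G| · ψ̃_τ(g) = Σ_χ χ(τ)⁻¹ K_{g, Λ^𝔪_χ}(0)`**: the smoothed coset sum through the character sums
`K_{g,Λ^𝔪_χ}(0) = Σ_n Λ^𝔪_χ(n) g(log n)` (`coefFordK (rcCoef 𝔪 (χ ∘ f)) g 0`), for `g` vanishing on `[x₀, ∞)`.
[cite: ThornerZaman2017, §8 (8.2)–(8.3)] -/
theorem card_mul_smoothedPsiFiber (τ : G) {g : ℝ → ℝ} {x₀ : ℝ} (hg : ∀ u, x₀ ≤ u → g u = 0) :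
    (Nat.card G : ℂ) * (smoothedPsiFiber 𝔪 f τ g : ℂ) =
      ∑ χ : AddChar (Additive G) ℂ, (χ (Additive.ofMul τ))⁻¹ * coefFordK (rcCoef 𝔪 (charFun f χ)) g 0 := by
  -- a common truncation
  obtain ⟨N, hN⟩ : ∃ N : ℕ, x₀ ≤ Real.log N ∧ 1 ≤ N := by
    obtain ⟨N, hN⟩ := exists_nat_gt (Real.exp x₀)
    have hN0 : (0 : ℝ) < N := (Real.exp_pos _).trans hN
    refine ⟨N, ?_, ?_⟩
    · rw [Real.le_log_iff_exp_le hN0]; exact hN.le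
    · exact_mod_cast Nat.one_le_iff_ne_zero.2 (by rintro rfl; simp at hN0)
  rw [smoothedPsiFiber_eq_sum τ hg hN.2 hN.1]
  simp_rw [coefFordK_eq_sum _ hg hN.2 hN.1, neg_zero, Complex.cpow_zero, mul_one, mul_sum]
  rw [sum_comm, ofReal_sum, mul_sum]
  refine sum_congr rfl fun n _ ↦ ?_
  simp_rw [← mul_assoc]
  rw [← sum_mul, sum_char_inv_mul_rcCoef, ofReal_mul]
  ring

omit [Finite G] in
/-- `0 ≤ ψ̃_τ(g)` for `g ≥ 0`. [cite: ThornerZaman2017, §8 (8.1)] -/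
theorem smoothedPsiFiber_nonneg (τ : G) {g : ℝ → ℝ} (hg : ∀ u, 0 ≤ g u) : 0 ≤ smoothedPsiFiber 𝔪 f τ g :=
  tsum_nonneg fun n ↦ mul_nonneg (vonMangoldtFiber_nonneg τ n) (hg _)

end Literature.NumberTheory.LFunctions.AbelianDensity

end
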